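import Summits.QuantumFields.YangMills.Theorems.BalabanUVNodesN07Thm4RecordStructureSym152PhiEG
import Literature.MathematicalPhysics.QuantumFieldTheory.Balaban1983to89.Node00.CriticalOnFibreTopGuardedB
import HarnessLib
/-!
# N07 [B11] (= [15] = [Balaban1985Variational]) Sect. F — THE (c-ii)‴ DOOR `hS3NORMSym152PhiE_of_hThm4RecSym152PhiEG` OVER A BOND DATUM AND A TOP-DATA PREDICATE (S1c of the (E1)∕(iii-b)
# work plan, director-ym №338∕№339; FLAG №16; LOCATE-HSEAM 5d3298b8d191f169): the SAME door with the HS3NORM clause's data row `Dat K s.Ω (suppDom) k δ W` and fibre rows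
# `AgreeOnB (bd K k s.Ω) (Ū U) W → IsCritOnFibreB F N K (bd K k s.Ω) W U` (F0c `Node00/CriticalOnFibreTopGuardedB`'s parameters) — the door IGNORES all three rows, so it holds for EVERY `(bd, Dat)`

Cell `pub-ymgap`, seat `pub-ymgap-dag-n07-e` g33 (FAN-OUT §N07 row s3; LANE OWNER of the K0 road chart side).  `--kind proof --supports stmt-QuantumFields-20541 --as helper` (K0⁷); count-neutral.
PRINT-DATUM TWIN of `…N07Thm4RecordStructureSym152PhiEG.hS3NORMSym152PhiE_of_hThm4RecSym152PhiEG` (FLAG №16 ∕ LOCATE-HSEAM 5d3298b8d191f169); the (b)-instance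
`hS3NORMSym152PhiE_of_hThm4RecSym152PhiEG` stays landed and true on its own text (it is the instance `bd := genSetDatum F`, `Dat := dataSmall7PTopOf F N` of the theorem below, by `rfl` on
the rows).  No displayed premise is deleted or weakened: the three rows become parameters.  [15] = [Balaban1985Variational]; [6] = [Balaban1985RegularSpaces]; [II] = [Balaban1984PropagatorsII];
[III] = [Balaban1988Convergent]; [I] = [Balaban1987RG1].

WHY.  The K0 chart road is re-keyed to print's [II] (2.3) datum «Λ_j = Ω_j^{(j)} ∖ Ω_{j+1}^{(j)} … for the sets of sites and the sets of bonds» (p. 224; ruling (α) of record: the DIFFERENCE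
of the bond sets — inward connectors belong to no `Λ_j`).  The premise `HThm4RecSym152PhiEG` (§2 of the parent file) is DATUM-FREE (it quantifies over `U` in the (1.7)-class only); its
door to the knit's HS3NORM-152 clause merely THREADS the clause's `W`-binder, data row and fibre rows (the parent proof names them `W _ U h17 h19 _ _`).  Hence the door holds verbatim for
every bond-datum family `bd : BondDatum F` and every top-data predicate `Dat : TopData F N`; the S1c twins of 77c⁗E ∕ 122′ consume it at `bd := lamDatum F`.

WHAT IS PROVED (sorry-free; 0 defs).  ★ `hS3NORMSym152PhiE_of_hThm4RecSym152PhiEG_B (bd) (Dat)` — OUTPUT = the parent door's HS3NORM-152 clause with the three rows parametrised, INPUT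
identical (`hc`, `hc₀`, `Adm`, `hAdm₁`, `hAdm₂`, `0 < B₃`, `0 < κ`, `hT : HThm4RecSym152PhiEG F N Mc ρ Md κ a₀ Ψ`); proof = the parent's, byte for byte.
HONEST LABEL (binding).  A threading door; `HThm4RecSym152PhiEG` is a CONDITIONAL premise and this file DISCHARGES NOTHING of it; K0⁷ stub 1 NOT closed; N07 NOT discharged; counts
unmoved (typed 28∕28 · discharged 8∕28); one finite 𝕋⁴ programme at fixed ε — nothing continuum ∕ ℝ⁴ ∕ OS ∕ mass gap ∕ Clay.  No `def`, no `instance`, no `notation`, no `sorry`.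

References: [6] Thm. 4 p. 88, Prop. 6 (1.130)–(1.138) p. 99; [15] (144) p. 300, (147)–(153) p. 301, (7) p. 278, Prop. 8 p. 304; [II] (2.3) p. 224; [III] (2.2) p. 255, (2.10) p. 256;
[I] (0.1) p. 251, (0.4)–(0.11) pp. 253–254.
-/

set_option autoImplicit false

noncomputable section
open scoped BigOperators Matrix.Norms.L2Operator

namespace Summit.QuantumFields.YangMills.BalabanUVNodes.N07Thm4RecordStructureSym152PhiEGB

open Literature.MathematicalPhysics.QuantumFieldTheory.Balaban1983to89
open Literature.MathematicalPhysics.QuantumFieldTheory.Balaban1983to89.Node00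
open Literature.MathematicalPhysics.QuantumFieldTheory.Balaban1983to89.B15DeterminingSets
open Literature.MathematicalPhysics.QuantumFieldTheory.Balaban1983to89.B15DeterminingSetsB
open Literature.MathematicalPhysics.QuantumFieldTheory.Balaban1983to89.B12RegularSpaces111 (gaugeU expI grad)
open B15Eq112TorusCover (cover)
open B14DomainGeom (Pt Within)
open B8Eq131Cubes (sqLo sqHi box cube)
open B5Eq118OneStroke (iterBlockOf)
open B6SectADomainsV1 (Domains)
open B6SectAOperatorsV1 (BondIdx RE dsE QpE)
open Literature.MathematicalPhysics.QuantumFieldTheory.BalabanImbrieJaffe1984to88.BIJ85AxialPropagator411 (BondSpace)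
open T4Continuum (T4Family)
open Summit.QuantumFields.YangMills.BalabanUVNodes.N07Thm4RecordStructureSym152Phi (NrmSymPhiOfRecord)
open Summit.QuantumFields.YangMills.BalabanUVNodes.N07Thm4RecordStructureSym152PhiEG (HThm4RecSym152PhiEG)
open Summit.QuantumFields.YangMills.BalabanUVNodes.N07DatumGauge152Guarded (two_mul_pow_le_sitesPerDir_of_levelGuard)
open GaugeField (gaugeAct)

variable (F : T4Family) (N : ℕ) [NeZero N]

/-- ★★★ **THE CONDITIONAL DOOR S1ᶜ, (152)-COMPLETE, GUARD EDITION, OVER `(bd, Dat)`** — print-datum twin of `hS3NORMSym152PhiE_of_hThm4RecSym152PhiEG` (FLAG №16 ∕ LOCATE-HSEAM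
5d3298b8d191f169); the (b)-instance stays landed and true on its own text: from `HThm4RecSym152PhiEG F N Mc ρ Md κ a₀ Ψ` and the knit's two guard implications `hAdm₁ ∕ hAdm₂`, with the side
conditions `(11·4 + 4ρ + Mc + 3)·L ≤ c`, `Mc + 11·4 + 6ρ ≤ 2·L^{c₀}`, `0 < B₃`, `0 < κ`: the HS3NORM-152 clause of the ε-indexed knit at `Nrm := NrmSymPhiOfRecord F N Mc ρ (Ψ ε j)` whose data row
is `Dat K s.Ω (suppDom) k δ W` and whose fibre rows are `AgreeOnB (bd K k s.Ω) (Ū U) W → IsCritOnFibreB F N K (bd K k s.Ω) W U` — for EVERY bond-datum family `bd` ([II] (2.3) `lamDatum F`, or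
reading (b) `genSetDatum F`) and EVERY top-data predicate `Dat` (the rows are threaded, never read). [cite: Balaban1985Variational, (144) p.300, (147)–(153) p.301, Prop. 8 p.304; Balaban1985RegularSpaces, Prop. 6 (1.130)–(1.138) p.99; Balaban1984PropagatorsII, (2.3) p.224; Balaban1987RG1, (0.4)–(0.11) pp.253–254] -/
theorem hS3NORMSym152PhiE_of_hThm4RecSym152PhiEG_B (bd : BondDatum F) (Dat : TopData F N) {ρ Mc Md : ℕ} {c c₀ : ℕ} (hc : (11 * 4 + 4 * ρ + Mc + 3) * F.L ≤ c) (hc₀ : Mc + 11 * 4 + 6 * ρ ≤ 2 * F.L ^ c₀)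
    (Adm : StepGuard F) (hAdm₁ : ∀ (ν : Stage7Numerics) (M : ℕ) (g : ℕ → ℝ) (K k : ℕ) (s : SeqOfRecord F ν M g K k), Adm ν M g K k s → c ≤ ν.M₁ ∧ k + c₀ ≤ F.m + K)
    (hAdm₂ : ∀ (ν : Stage7Numerics) (M : ℕ) (g : ℕ → ℝ) (K k : ℕ) (s : SeqOfRecord F ν M g K k), Adm ν M g K k s → ∀ i : ℕ, 1 ≤ i → i ≤ k →
      Md ∣ M * RkOfRecord (F.P K).L ν.r (g i) ∧ dCubeSide (F.P K).L M (RkOfRecord (F.P K).L ν.r (g i)) i ∣ (F.P K).sitesPerDir 0)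
    {B₃ κ a₀ a₁ : ℝ} (hB₃ : 0 < B₃) (hκ : 0 < κ) {Ψ : (ℕ → ℝ) → ℕ → ℝ} (hT : HThm4RecSym152PhiEG F N Mc ρ Md κ a₀ Ψ) :
    ∀ (ν : Stage7Numerics) (M : ℕ) (g : ℕ → ℝ) (K k : ℕ) (s : SeqOfRecord F ν M g K k), Sect2.SeqSeparated ν.M₁ s → 0 < ν.M₁ →
      Adm ν M g K k s → 1 ≤ k →
      ∀ (ε δ : ℕ → ℝ),
      (∀ n, n ≤ k → 0 < δ n ∧ δ n ≤ a₁) → (∀ n, n < k → δ n ≤ 2 * δ (n + 1)) → (∀ n, n < k → δ (n + 1) ≤ 2 * δ n) →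
      (∀ n, n ≤ k → B₃ * δ n ≤ ε n ∧ ε n ≤ a₀) → (∀ n, n < k → ε n ≤ 2 * ε (n + 1)) → (∀ n, n < k → ε (n + 1) ≤ 2 * ε n) →
      ∀ W : MSField (F.P K) (SU N), Dat K s.Ω (suppDomOfRecord F ν K s.Ω) k δ W →
      ∀ U : GaugeField (F.P K) 0 (SU N),
      (∀ n, n ≤ k → PlaqSmallOn (Sect2.omegaPlaqsTop s.Ω (suppDomOfRecord F ν K s.Ω) n) (ε n * (F.P K).eta n ^ 2) U) →
      (∀ n, n ≤ k → Sect2.CoDivSmallOn (Sect2.omegaBondsTop s.Ω (suppDomOfRecord F ν K s.Ω) n) (ε n * (F.P K).eta n ^ 3) U) →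
      AgreeOnB (bd K k s.Ω) (avgFamily (avOfRecord F N K) U) W → IsCritOnFibreB F N K (bd K k s.Ω) W U →
      ∀ (n : ℕ) (hk : K - n ≤ (F.P K).m + (F.P K).K), 1 ≤ K - n → K - n ≤ k → ∀ (idx : Pt (F.P K).d),
      (∃ x ∈ box (F.P K).L (cornerP (F.P K) Mc ρ idx) (sideP (F.P K) Mc ρ) (K - n), ∃ y : Pt (F.P K).d, cover (F.P K) y ∈ s.Ω (K - n) ∧ Within ((3 : ℕ) : ℤ) x y) →
      (K - n = k ∨ ∀ z ∈ box (F.P K).L (cornerP (F.P K) Mc ρ idx - ((2 * ρ : ℕ) : Pt (F.P K).d)) (sideP (F.P K) Mc ρ + 2 * (2 * ρ)) (K - n),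
        cover (F.P K) z ∉ s.Ω (K - n + 1)) →
      ∃ (u : GaugeTransf (F.P K) 0 (SU N)) (A : PBond (F.P K) 0 → MatA N),
      (∀ b ∈ (Sect2.regionOfSet (F.P K) (cover (F.P K) '' box (F.P K).L (cornerP (F.P K) Mc ρ idx) (sideP (F.P K) Mc ρ) (K - n))).bonds,
        gaugeU (fun x => ιSU N (u x)) (fun b' => ιSU N (U b')) b = expI ((F.P K).eta (K - n)) (A b)) ∧
      (∀ b ∈ (Sect2.regionOfSet (F.P K) (cover (F.P K) '' cube (F.P K).L (cornerP (F.P K) Mc ρ idx) (sideP (F.P K) Mc ρ) ρ (K - n) 0)).bonds,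
        gaugeU (fun x => ιSU N (u x)) (fun b' => ιSU N (U b')) b = expI ((F.P K).eta (K - n)) (A b)) ∧
      (∀ j', j' ≤ K - n →
        ∀ b ∈ (Sect2.regionOfSet (F.P K) (cover (F.P K) '' cube (F.P K).L (cornerP (F.P K) Mc ρ idx) (sideP (F.P K) Mc ρ) ρ (K - n) j')).bonds,
          ‖A b‖ < κ * ε (K - n) * ((F.P K).L : ℝ) ^ (K - n - j')) ∧
      (∀ j', j' ≤ K - n →
        ∀ q ∈ (Sect2.regionOfSet (F.P K) (cover (F.P K) '' cube (F.P K).L (cornerP (F.P K) Mc ρ idx) (sideP (F.P K) Mc ρ) ρ (K - n) j')).dpairs,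
          ‖grad ((F.P K).eta (K - n)) q.2.1 (fun y => A ⟨y, q.2.2⟩) q.1‖ < κ * ε (K - n) * ((F.P K).L : ℝ) ^ (2 * (K - n - j'))) ∧
      (∀ b ∈ (Sect2.regionOfSet (F.P K) (cover (F.P K) '' box (F.P K).L (cornerP (F.P K) Mc ρ idx) (sideP (F.P K) Mc ρ) (K - n))).bonds,
        ‖A b‖ < κ * ε (K - n)) ∧
      (∀ q ∈ (Sect2.regionOfSet (F.P K) (cover (F.P K) '' box (F.P K).L (cornerP (F.P K) Mc ρ idx) (sideP (F.P K) Mc ρ) (K - n))).dpairs,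
        ‖grad ((F.P K).eta (K - n)) q.2.1 (fun y => A ⟨y, q.2.2⟩) q.1‖ < κ * ε (K - n)) ∧
      (∀ b ∈ Sect2.bondsDeep (cover (F.P K) '' box (F.P K).L (cornerP (F.P K) Mc ρ idx) (sideP (F.P K) Mc ρ) (K - n)),
        ‖Sect2.codiffCurlA ((F.P K).eta (K - n)) A b.src b.dir‖ < κ * ε (K - n)) ∧
      (∀ b ∈ Sect2.bondsDeep (cover (F.P K) '' box (F.P K).L (cornerP (F.P K) Mc ρ idx) (sideP (F.P K) Mc ρ) (K - n)),
        ‖∑ ν' : Fin (F.P K).d, (((F.P K).eta (K - n) : ℝ) : ℂ)⁻¹ •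
            (grad ((F.P K).eta (K - n)) ν' (fun y => A ⟨y, b.dir⟩) (b.src.unshift ν') - grad ((F.P K).eta (K - n)) ν' (fun y => A ⟨y, b.dir⟩) b.src)‖ <
          κ * ε (K - n)) ∧
      (∀ D' : Domains (F.P K), LinearMap.ker (QpE D') ≤
          LinearMap.ker (QpE (domainsMeet (cubeDomains (F.P K) (cornerP (F.P K) Mc ρ idx) (sideP (F.P K) Mc ρ) ρ (K - n) hk) (domainsOfSeq s.Ω (K - n) hk))) →
        ∀ φ : MatA N →L[ℂ] ℂ,
        RE D' ((F.P K).eta (K - n))⁻¹ (dsE ((F.P K).eta (K - n))⁻¹ (WithLp.toLp 2 fun b => (φ (A b)).re : BondSpace (F.P K))) = 0 ∧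
        RE D' ((F.P K).eta (K - n))⁻¹ (dsE ((F.P K).eta (K - n))⁻¹ (WithLp.toLp 2 fun b => (φ (A b)).im : BondSpace (F.P K))) = 0) ∧
      NrmSymPhiOfRecord F N Mc ρ (Ψ ε (K - n)) ν M g K k s U (K - n) idx u A := by
  intro ν M g K k s hsep hM₁ hadm hk1 ε δ hδ _ _ hεr hcomp _ W _ U h17 h19 _ _ n hk hn1 hnk idx hdat _
  obtain ⟨hcν, hlevF⟩ := hAdm₁ ν M g K k s hadm
  have hfl : (11 * 4 + 4 * ρ + Mc + 3) * F.L ≤ ν.M₁ := hc.trans hcν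
  have hlevP : k + c₀ ≤ (F.P K).m + (F.P K).K := by rw [T4Family.P_m, T4Family.P_K]; exact hlevF
  have hlev : Mc + 11 * 4 + 6 * ρ ≤ (F.P K).sitesPerDir k := by
    refine hc₀.trans ?_
    have := two_mul_pow_le_sitesPerDir_of_levelGuard (P := F.P K) le_rfl hlevP
    rwa [T4Family.P_L] at this
  have hε : ∀ m, m ≤ k → 0 < ε m ∧ ε m ≤ a₀ := fun m hm =>
    ⟨lt_of_lt_of_le (mul_pos hB₃ (hδ m hm).1) (hεr m hm).1, (hεr m hm).2⟩
  obtain ⟨u, A, h1, hT1, hT2, hT2b, h2, h3, h4, h5, h6, hN⟩ :=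
    hT hκ ν M g K k s hsep hM₁ hfl hlev hk1 (hAdm₂ ν M g K k s hadm) ε hε hcomp U h17 h19 (K - n) hk hn1 hnk idx hdat
  exact ⟨u, A, h1, hT1, hT2, hT2b, h2, h3, h4, h5, fun D' hD' φ => ⟨RE_eq_zero_of_ker_le hD' (h6 φ).1, RE_eq_zero_of_ker_le hD' (h6 φ).2⟩, hN⟩

end Summit.QuantumFields.YangMills.BalabanUVNodes.N07Thm4RecordStructureSym152PhiEGB

end
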